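import Summits.ABC.ABC.Theses.RibetTakahashiSplit

/-!
# Maximal order of `ω(n)`: `ω(n) · log log n ≤ C₀ · log n`

Stub `stub_omegaLogLog` of the line `unramified-window-census` for the crux
`Summit.ABC.ABC.Theses.RibetTakahashiSplit.ManyPrimeValuationProduct`: the crude maximal-order
bound for the number of distinct prime factors, with the explicit constant `C₀ = 4`
(Hardy–Wright §22.10 gives the sharp order `log n / log log n`; any constant suffices here).

Elementary proof: put `L = log n` and split the prime factors of `n` at `y = √L`.
At most `y` of them are `≤ y` (they are positive integers `≤ y`), and the product of those `> y`
divides `n`, so there are at most `L / log y = 2L / log L` of them.  Hence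
`ω(n) · log L ≤ √L · log L + 2L ≤ 4L`, using `log L = 2 log √L ≤ 2√L`.  For `L ≤ 1`
(i.e. `n ≤ 2`) the left-hand side is `≤ 0 ≤ 4L` (conventions `Real.log 0 = 0`,
`Real.log x ≤ 0` for `x ≤ 1`).
-/

-- `Summit.<Summit>.<Problem>` is the mandated summit-side namespace (CONVENTIONS §2); for the
-- single-conjunct summit `ABC` the two coincide, so the duplicate `ABC.ABC` is deliberate.
set_option linter.dupNamespace false

namespace Summit.ABC.ABC.Theorems

open Finset

/-- The product over any sub-finset `T` of the prime factors of `n ≠ 0` is at most `n`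
(it divides the radical of `n`, which divides `n`). `[folklore]` -/
theorem ManyPrimeValuationProduct.prod_le_of_subset_primeFactors {n : ℕ} (hn : n ≠ 0)
    {T : Finset ℕ} (hT : T ⊆ n.primeFactors) : ∏ p ∈ T, p ≤ n :=
  Nat.le_of_dvd (Nat.pos_of_ne_zero hn)
    ((Finset.prod_dvd_prod_of_subset _ _ (fun p : ℕ => p) hT).trans (Nat.prod_primeFactors_dvd n))

/-- Large prime factors are few: for `n ≠ 0` and `y > 0`, the number `b` of prime factors
`p` of `n` with `p > y` satisfies `b · log y ≤ log n` (because `y ^ b ≤ ∏ p ≤ n`). `[folklore]` -/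
theorem ManyPrimeValuationProduct.card_primeFactors_gt_mul_log_le {n : ℕ} (hn : n ≠ 0)
    {y : ℝ} (hy : 0 < y) :
    ((n.primeFactors.filter fun p : ℕ => ¬ ((p : ℝ) ≤ y)).card : ℝ) * Real.log y
      ≤ Real.log n := by
  set B := n.primeFactors.filter fun p : ℕ => ¬ ((p : ℝ) ≤ y) with hB
  have h1 : y ^ B.card ≤ ∏ p ∈ B, (p : ℝ) := by
    rw [← Finset.prod_const]
    refine Finset.prod_le_prod (fun _ _ => hy.le) (fun p hp => ?_)
    rw [hB, Finset.mem_filter] at hp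
    exact (not_le.1 hp.2).le
  have h2 : ∏ p ∈ B, p ≤ n :=
    ManyPrimeValuationProduct.prod_le_of_subset_primeFactors hn (Finset.filter_subset _ _)
  have h3 : ∏ p ∈ B, (p : ℝ) ≤ (n : ℝ) := by
    calc ∏ p ∈ B, (p : ℝ) = ((∏ p ∈ B, p : ℕ) : ℝ) := by rw [Nat.cast_prod]
      _ ≤ n := Nat.cast_le.2 h2
  rw [← Real.log_pow]
  exact Real.log_le_log (pow_pos hy _) (h1.trans h3)

/-- Small prime factors are few: for `y ≥ 0`, the number of prime factors `p` of `n` with `p ≤ y`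
is at most `y` (they are positive integers `≤ ⌊y⌋`). `[folklore]` -/
theorem ManyPrimeValuationProduct.card_primeFactors_le_le (n : ℕ) {y : ℝ} (hy : 0 ≤ y) :
    ((n.primeFactors.filter fun p : ℕ => (p : ℝ) ≤ y).card : ℝ) ≤ y := by
  have hsub : (n.primeFactors.filter fun p : ℕ => (p : ℝ) ≤ y) ⊆ Finset.Icc 1 ⌊y⌋₊ := by
    intro p hp
    rw [Finset.mem_filter] at hp
    rw [Finset.mem_Icc]
    exact ⟨(Nat.prime_of_mem_primeFactors hp.1).one_le, Nat.le_floor hp.2⟩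
  calc ((n.primeFactors.filter fun p : ℕ => (p : ℝ) ≤ y).card : ℝ)
        ≤ ((Finset.Icc 1 ⌊y⌋₊).card : ℝ) := by exact_mod_cast Finset.card_le_card hsub
    _ = (⌊y⌋₊ : ℝ) := by rw [Nat.card_Icc, Nat.add_sub_cancel]
    _ ≤ y := Nat.floor_le hy

/-- **Maximal order of `ω` (crude form).** There is an absolute constant `C₀` (here `C₀ = 4`)
such that `ω(n) · log log n ≤ C₀ · log n` for every natural number `n`, where
`ω(n) = n.primeFactors.card`; the cases `n ≤ 2` hold because then `log log n ≤ 0 ≤ log n`.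
Cf. Hardy–Wright, *An Introduction to the Theory of Numbers*, §22.10. `[folklore]` -/
theorem stub_omegaLogLog :
    ∃ C₀ : ℝ, ∀ n : ℕ, (n.primeFactors.card : ℝ) * Real.log (Real.log n) ≤ C₀ * Real.log n := by
  refine ⟨4, fun n => ?_⟩
  have hL0 : 0 ≤ Real.log n := Real.log_natCast_nonneg n
  rcases le_or_gt (Real.log n) 1 with hL1 | hL1
  · -- `log n ≤ 1`: the left-hand side is non-positive.
    have h1 : Real.log (Real.log n) ≤ 0 := Real.log_nonpos hL0 hL1
    have h2 : (n.primeFactors.card : ℝ) * Real.log (Real.log n) ≤ 0 :=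
      mul_nonpos_of_nonneg_of_nonpos (Nat.cast_nonneg _) h1
    linarith
  · -- `1 < log n`: split the prime factors at `y = √(log n)`.
    have hn : n ≠ 0 := by
      rintro rfl
      rw [Nat.cast_zero, Real.log_zero] at hL1
      exact absurd hL1 (by norm_num)
    set L : ℝ := Real.log n with hL
    set y : ℝ := Real.sqrt L with hy
    have hy0 : 0 < y := Real.sqrt_pos.2 (by linarith)
    have hlogy : Real.log y = Real.log L / 2 := Real.log_sqrt hL0
    have hlogL : 0 < Real.log L := Real.log_pos hL1
    have hyy : y * y = L := Real.mul_self_sqrt hL0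
    -- `log L ≤ 2 y`
    have hlogL2 : Real.log L ≤ 2 * y := by
      have h := Real.log_le_sub_one_of_pos hy0
      rw [hlogy] at h
      linarith
    -- the split `ω = a + b`
    have hcard : (n.primeFactors.card : ℝ)
        = ((n.primeFactors.filter fun p : ℕ => (p : ℝ) ≤ y).card : ℝ)
          + ((n.primeFactors.filter fun p : ℕ => ¬ ((p : ℝ) ≤ y)).card : ℝ) := by
      rw [← Nat.cast_add, Finset.card_filter_add_card_filter_not]
    have ha : ((n.primeFactors.filter fun p : ℕ => (p : ℝ) ≤ y).card : ℝ) ≤ y :=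
      ManyPrimeValuationProduct.card_primeFactors_le_le n hy0.le
    have hb : ((n.primeFactors.filter fun p : ℕ => ¬ ((p : ℝ) ≤ y)).card : ℝ) * Real.log L
        ≤ 2 * L := by
      have h := ManyPrimeValuationProduct.card_primeFactors_gt_mul_log_le hn hy0
      rw [hlogy] at h
      linarith
    calc (n.primeFactors.card : ℝ) * Real.log L
          = ((n.primeFactors.filter fun p : ℕ => (p : ℝ) ≤ y).card : ℝ) * Real.log L
            + ((n.primeFactors.filter fun p : ℕ => ¬ ((p : ℝ) ≤ y)).card : ℝ) * Real.log L := by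
            rw [hcard]; ring
      _ ≤ y * Real.log L + 2 * L :=
            add_le_add (mul_le_mul_of_nonneg_right ha hlogL.le) hb
      _ ≤ y * (2 * y) + 2 * L := by gcongr
      _ = 4 * L := by rw [show y * (2 * y) = 2 * (y * y) by ring, hyy]; ring

end Summit.ABC.ABC.Theorems
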